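/- Copyright: the b2b-balaban cell (near-miss cell 7), T⁴-continuum fan-out, ROUND-2 swarm `t4-ne7b-formalise-*`
(leaf 08), row NE7b (node U5c COUNT member).  Released under the licence of the surrounding project. -/
import Summits.QuantumFields.BalabanUV.T4Continuum.Support.HistoryAdmissible

/-!
# Admissible histories: the sentence table and decided toy instances (swarm row S2 = leaf H1b)

Summits-side support leaf of the T⁴-continuum cell (rung (B)+1 on a FINITE torus only; NOT infinite volume, NOT the
mass gap, NOT the Clay statement; NOT a proof of the spine estimate NE7b).  Row S2 of the swarm claim table
`t4/b2b-balaban-t4-ne7b-p1/LEAVES-NE7b.md` (leaf H1b of `SKELETON-NE7b-P1.md` §2∕§4 as tabled in v1.3): the CROSS-READ of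
row S1 as landed — `HistoryAdmissible.PGen` (the combinatorial skeleton of print's inductive description), its canonical
label `toGen`, and the predicates `TypeNodup` ∕ `Adm` ∕ `RenewAtReach` ∕ `JoinInLife` — against B16 §1 pp. 383–387, in
three checkable forms: (§0) the XREAD verdict with its two divergences from the tabled row text; (§1) a
sentence-by-sentence table «printed sentence ↦ constructor ∕ predicate clause ∕ deferred to the geometric layer ∕ not
data» kept as comments; (§2) DECIDED TOY HISTORIES exercising each printed case once (one region with no event; a
renewal of a READY component; an m1 merger = component + new region; an m2 merger = two old components) and the
convention ∕ census cases of the owner's rulings (H-GROUP faithful vs grouped; a one-step triple join and its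
serialisation; the equal-class twin; a renewal before the booked reach), each with `TypeNodup`, `Adm`, `RenewAtReach`,
`JoinInLife`, the booked windows and reaches, and `Consistent` ∕ `WF` of the label decided or derived by S1's
`consistent_toGen` ∕ `wf_toGen` ∕ `not_wf_toGen`.
[folklore] model data over the lineage's OWN typed carrier; nothing is quoted from print as a fact, nothing printed is
asserted, nothing of Bałaban's is constructed; no `[cite:]` tag; no `def … : Prop` fact (trigger c1); the toy sizes
live only inside `example`s ∕ sanity theorems about the TOY data (trigger c6: no landed statement about Bałaban's runs is
specialised to numerals).

SOURCE UNDER AUDIT (read as images on the ×2 renders `b2b-balaban-ref1/pages/1989-cmp122-large-field-II/…-p029…p033-x2.png`,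
journal page = render + 354): T. Bałaban, *Large field renormalization. II. Localization, exponentiation, and bounds for
the R operation*, Commun. Math. Phys. 122, 355–392 (1989) [Balaban1989LargeFieldII] = cell paper B16, §1 pp. 383–387;
conditions (i), (ii) = [Balaban1989LargeFieldI] (B15) p. 177 (cell record `t4/T4-XREAD-U4.md` (Q7)).  The manuscript is
the thing under adjudication: its sentences are TRANSCRIBED here to check that S1's data structure has a field for each,
never used as established facts.

HONEST.  A transcription check and inhabited toy data; proves no estimate; H3 (that Bałaban's R-operation produces terms
indexed by these histories) stays the displayed reading it was.  NE7b NOT proved; spine 0∕9.  HONEST DEPENDENCY (cell):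
continuum YM on T⁴ ⇐ BetaPertH ∧ nine spine estimates (0/9 proved); BetaPertH ⇐ (D1) ∧ (D4) ∧ CAP+tail; G-an2-4 gates
asym, D1 and NE2/3/4.  This file changes none of it. -/

open Finset
open Literature.MathematicalPhysics.QuantumFieldTheory.Balaban1983to89
open T4PersistenceDictionary T4PrintedShapeBanking
open Summit.QuantumFields.BalabanUV.T4Continuum.HistoryAdmissible

namespace Summit.QuantumFields.BalabanUV.T4Continuum.HistoryAdmissibleSanity

/-! ## §0 XREAD verdict on row S1 as landed (`Support/HistoryAdmissible.lean` v1, p207789, 323 l.)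

PASS as what its header says it is — the COMBINATORIAL SKELETON `PGen` of print's inductive description (birth ∕
renewal of a ready component ∕ binary join along print's maximal tree, physical steps) with the canonical label `toGen`
into `T4PersistenceDictionary.Gen PEv` (birth ↦ `(j,0,d′)` born `j`; renewal ready at `h` ↦ `(h+1,1,0)`; join at `s` ↦
`(s,2,0)` — the event types of the dictionary's D1∕D2∕D3), the decided census `distinct_toGen_iff`∕`not_wf_toGen`, the
timing discipline `Adm`, the model-time side conditions `RenewAtReach`∕`JoinInLife`, the positive half
`consistent_toGen`∕`wf_toGen`, and H-GROUP monotonicity.  Trigger c1 ✓ (`PGen` is data; `TypeNodup`, `Adm`,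
`RenewAtReach`, `JoinInLife`, `DistinctEv` are parametrised predicates; H3 not minted), c2∕c6 ✓ (no numeral outside
`Sanity`).  Two divergences from the claim-table text of row S1 (v1.3), both ANNOUNCED in S1's own header, recorded so
the typer∕owner re-cut the table rather than anyone looking for the content here:
* DV-S1-1 — the GEOMETRIC REALISATION (regions as face-connected cube families, fatness `treeLen`, the operation `S` ∕
  `Siter`, (1.76)∕(1.84) containment, readiness by (i)∕(ii) with `N = R_j`, integration-out at readiness; rows T0, T0′,
  T5, T8–T10, T15, T23 (connectedness), T26, T29 (physical horizon) of §1) is NOT in S1 v1; S1 defers it to «H1b,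
  separate leaf».  Its [K] ingredients exist in the tree (`B16SProfile`, `B16StoppingRule.{CondI, CondII, StopAt,
  find_stopAt_le}`, `B16MergeHorizon.find_stopAt_merge_le`, `B16MergeGeometry`); the junction «physical life ≤ booked
  reach `toGen.reach (dictW R n₁)`» (which would DERIVE `Adm`, `JoinInLife` and the socket's `pending` for print's
  histories instead of displaying them) is open.
* DV-S1-2 — `JoinArity` (ruling R-A of LEAVES v1.4) is not defined; superseded by `TypeNodup` (v1.5), and §2's `tri`
  decides that a one-step join of three old components is exactly a `TypeNodup` failure (event `(s,2,0)` twice), while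
  its serialisation over two steps (`triSerial`) is `TypeNodup` but leaves `JoinInLife` — the corner case F-1(b) names.
Remarks (non-blocking): (r1) `Adm` lets the endpoint `X` of `join X Y s` be itself a join dated `s` (print's endpoint is
ONE vertex of the graph G — a component of `Z_j` or a new region); harmless over-generation, like flag (S4) of the
reading record.  (r2) `RenewAtReach` pins the renewal to the BOOKED reach (finding F-1(c)); §2's `renEarly` is a
physically admissible history outside the certified sub-class — the honest content of «`TypeNodup ∧ RenewAtReach`
displayed».  (r3) `rootCell`'s tie-break «towards the endpoint» matches `Gen.root`'s.
-/

/-! ## §1 The sentence table: B16 §1 pp. 383–387 (+ p. 381 (1.76), B15 p. 177 (i)(ii)) ↦ `AdmissibleHistory`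

Legend of the KIND column: DATA = a field of S1's structure; WF = a clause of its well-formedness predicate; DEF = an
EXISTING tree definition the field is typed with (`B16SProfile.Sop`∕`Siter`∕`closureIdx`, `TreeLength.treeLen`,
`B13ScaleTransfer.FaceConnected`, `ZoneTorus.TCell`∕`IsScale`); RD = the reading (ID) already booked in
`T4PersistenceDictionary` (`Gen`, `dictW`, `fatWait`; record `t4/T4-XREAD-NE7b-READING.md` V1–V6, D1–D7); EST = an
ESTIMATE or a constant of print — NOT data, belongs to rows P∕F∕G of the skeleton and has NO field here (listed so that
the table is complete and nobody looks for it in S1).  «…» = the printed sentence, transcribed from the ×2 renders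
(p. 38n = render p0(n−354)); line positions counted on the render.  FIELD = S1's declaration realising it (filled
against the landed `Support/HistoryAdmissible.lean`); ✓∕✗∕— = matches ∕ diverges (with the divergence) ∕ not applicable.

T0  p.381 (1.76)      «Z_j ⊂ Z′^{~10}_{j−1} ∪ ⋃_i (Z_j^{(i)})^{~2}.»   WF (geometric)   FIELD: — NOT in S1 v1 (the
                       geometric realisation is deferred by S1's header to a separate leaf «H1b»); see §0 verdict DV-S1-1
T0′ B15 p.177 (i)(ii) «(i) it is contained in a cube of the size 100MR_k, (ii) in the preceding N renormalization steps
                       no new large field regions were created inside this component, and the previous regions contained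
                       in it satisfy the condition (i) on the corresponding scales.» (with «N = R_j», T10)  WF (readiness)
                       FIELD: — NOT in S1 v1 (geometric; [K] form exists: `B16StoppingRule.CondI`∕`CondII`∕`StopAt`); the
                       skeleton keeps only «READY at h» as the datum `h` of `PGen.renew G h` + `Adm`'s `lastStep ≤ h`
T1  p.383 l.14–15     «We assume that 2p₁ − (d+5)r₀ > p₀, and we estimate the factors by exp(−p₀(g_j)).»  EST (P1) —
T2  p.383 l.22–23     «Finally, the summations over the admissible sequences can be replaced by the factors
                       exp O(1)(MR_j)^{−d}|Z_j|.»                                                        EST (G2, D7) —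
T3  p.383 (1.79)      «T′_k(X)1 ≤ sup exp{Σ_{j=1}^k O(1)M^dR_j^{d+1}d′_j(Z_j)} · Π_{j=1}^k Π_i exp(−½γ₀A₁²p₀²(g_j)
                       (d′_j(Z_j^{(i)})+1) − 2p₀(g_j)) Π′ exp(−p₀(g_j))»            EST; its INDEX SETS are DATA (D1: the
                       regions Z_j^{(i)} with fatness d′_j; D2: the primed components)  FIELD: `PGen.birth j cls cell`
                       (step, class d′, root cell) ✓; `PGen.renew` ✓ (the region itself as a cube family: — deferred)
T4  p.383 after (1.79) «where the last product is over components of Z_j satisfying the conditions (i), (ii), for which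
                       some large fields are created during the preparatory steps.»        DATA+WF (renewal of a READY
                       component only)  FIELD: `PGen.renew G h` («READY at h, renewed at h+1») + `Adm`: `G.lastStep ≤ h ∧ h+1 ≤ K`
                       ✓ as skeleton; readiness ITSELF ((i),(ii)) — deferred; model side `RenewAtReach` (F-1(c))
T5  p.383             «The supremum is taken over all admissible domains, satisfying all the conditions described in the
                       previous sections, in particular the conditions (1.76).»             WF (T0 at every step)  FIELD: — deferred (geometric)
T6  p.384 l.5–6       «The product of factors coming from the first j steps is connected with the region Z_j, and can be
                       factorized in components of Z_j.»                                    DATA (pending components per step)  FIELD: one `PGen` per pending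
                       component ✓ (the per-step family of components of a TERM = the assembly's `live K c`, not S1)
T7  p.384 l.6–9       «If Z is a component of Z_j, and j(Z) is the index of a first large field region contained in Z,
                       then we write the factor connected with Z in the form exp(−κ_j(Z) − 2p₀(g_{j(Z)})).»  RD (root =
                       first birth, `Gen.rootStep`); DATA (constituents)  FIELD: `PGen.rootStep` (= min over joins),
                       `PGen.rootCell`, `PGen.regions`; `rootStep_toGen` ✓
T8  p.384 l.11–14     «If Z is a union of MR_j-cubes of the lattice T_ξ, ξ = L^{−j}, then we take the cover Z′ of Z by a
                       smallest union of LMR_{j+1}-cubes, and we add ten layers of such cubes. We denote the obtained domain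
                       by S(Z), i.e., S(Z) = Z′^{~10}.»                     DEF (`B16SProfile.Sop q = collar^[10] ∘ closureIdx q`)
                       FIELD: — deferred (geometric; [K] `B16SProfile`)
T9  p.384 l.14–16     «Such a domain arises as a new large field region in our procedure, if no large fields are created
                       in a neighborhood of Z, more precisely in S(Z)∖Z. The operation S may be iterated.»  DATA∕WF (case
                       «no new field»: Z ↦ S(Z)); DEF (`Siter`)  FIELD: no constructor — a no-event step is the
                       absence of an event between `lastStep` and the next one ✓ (faithful: print's case 1 changes κ, not Z's
                       history); S-images — deferred
T10 p.384 statement   «The factor exp(−κ_j(Z)) controls K renormalization steps, under the assumption that no large fields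
                       are created in these steps, where the number K is the smallest positive integer having the property
                       that the domain S^K(Z), considered as a domain in the lattice of the scale L^{−(j+K)}, satisfies
                       the conditions (i), (ii), with N = R_j.»              WF (readiness; integration-out AT readiness)
                       FIELD: — deferred ([K] `B16StoppingRule.StopAt`, `find_stopAt_le`); booked side = `Gen.reach (dictW R n₁)`
T11 p.384 (1.80)      «κ_j(Z) ≥ Σ_{n=j+1}^{j+K} O(1)M^dR_n^{d+1}d′_n(S^{n−j}(Z))»                           EST (P2) —
T12 p.384             «S^{n−j}(Z) = ⋃_{□⊂Z} S^{n−j}(□). It is easy to see that S^{n−j}(□) is a cube, which is a union of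
                       L^d_{n−j}MR_n-cubes, where L_{n−j} ≤ 42(1−L^{−(n−j)})∕(1−L^{−1}) < 63.»  [K] `B16SProfile` Parts 1–4 —
T13 p.384             «d′_n(S^{n−j}(Z)) ≤ (63)^d(MR_n)^{−d}|Z^{(n−j)}| ≤ (63)^d3·2^{d−1}d′_n(Z^{(n−j)}) if the linear size
                       on the right-hand side is different from 0, or d′_n(S^{n−j}(Z)) ≤ (64)^d if it is equal to 0.»  [K]
                       `B16SProfile` Part 5 —
T14 p.384∕385 l.1     «d′_n(Z^{(n−j)}) ≤ L^{−1∕2(n−j)}d′_j(Z) ≤ 2^{−(n−j)}d′_j(Z)» «for n − j > 1.»  [K]; RD `fatWait` —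
T15 p.385 l.3–7       «Let n₀ be the last index n such that d′_n(Z^{(n−j)}) > 0. Then S^{n₀+1−j}(Z) is contained in a cube
                       of the size 64MR_{n₀+1}, hence it satisfies the condition (i), and doing at most R_j further steps we
                       obtain a domain satisfying both conditions (i), (ii). Thus K ≤ n₀ − j + R_j»  RD (`dictW (j,0,d′) =
                       fatWait d′ + R_j + 1`); WF (a region without events is integrated out at its readiness)  FIELD:
                       booked side only (`toGen` births carry `(j,0,d′)`, window `dictW`); physical side — deferred
T16 p.385 (1.81)      «… ≤ O(1)(64)^dM^dL^{d+1}R_j^{d+2}(d′_j(Z) + 1).»                                  EST (P1∕P3) —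
T17 p.385 l.13–16     «Take a component Z of the region Z₁. It is determined by some of the large field regions Z₁^{(i)},
                       in the sense that the property (1.76) is satisfied, i.e., Z ⊂ ⋃_i (Z₁^{(i)})^{~2}.»  DATA∕WF (first
                       step: components = groups of new regions whose 2-collars join)  FIELD: `birth`∕`join … j` at the
                       first step ✓ (several co-born regions = joins dated j, or H-GROUP); 2-collar contact — deferred
T18 p.385 (1.82)+     «κ₁(Z) ≥ ¼γ₀(14)^{−d}A₁²p₀²(g₁)(d′₁(Z)+1) − O(1)M^dR₁^{d+1}d′₁(Z).» ∕ «¼γ₀(14)^{−d}A₁²p₀²(g₁) ≥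
                       O(1)2(64)^dM^dL^{d+1}R₁^{d+2}. This condition is satisfied for p₀ large, and g₁ sufficiently small.»
                       EST (P3 birth credit vs floor; F) —
T19 p.385 l.−7…−4     «We consider two cases. In the first case no large fields were introduced in the last step, hence
                       Z = S(Z₀), where Z₀ is a component of Z_j, and from the definition of κ_{j+1}(Z) we have (1.83)
                       κ_{j+1}(Z) = κ_j(Z₀) − O(1)M^dR_{j+1}^{d+1}d′_{j+1}(Z).»     DATA (case 1 per component and step)  FIELD: see T9 ✓
T20 p.385 l.−3–p.386 l.3 «In this case we should consider also the domains Z such that Z = S(Z₀), Z₀ satisfies the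
                       conditions (i), (ii), and a new large field was introduced in the preparatory operations. Then
                       κ_j(Z₀) ≥ 0, and we do not have a better bound for it, but we have the new factor exp(−p₀(g_j)). We
                       define κ_{j+1}(Z) = p₀(g_j) − O(1)M^dR_{j+1}^{d+1}d′_{j+1}(Z). It satisfies (1.80), because Z is a
                       small domain, it is contained in a cube of the size 100MR_{j+1}, hence K = R_{j+1} for Z.»  DATA+WF
                       (case 2: RENEWAL of a READY component; the renewed Z = S(Z₀) is pending again); RD (`dictW (s,1,·)
                       = R_s + 1`, `Gen.renew`)  FIELD: `PGen.renew G h`, label `(h+1,1,0)` by `toGen` ✓; `RenewAtReach W`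
                       books «K = R_{j+1}» at the BOOKED reach (F-1(c): print renews at PHYSICAL readiness ≤ booked —
                       §2 `renEarly` decides the gap)
T21 p.386 l.3–8       «In the second case Z is obtained from some number of components of Z_j, and some number of new
                       large field regions, joined together into the one component of Z_{j+1} by the operations of the
                       last step, in particular by adding layers of MR_{j+1}-cubes. Denote the components of Z_j by
                       Z_j^{(n)}, and the new large field regions by Z_{j+1}^{(i)}. The property (1.76) implies (1.84)
                       Z ⊂ ⋃_n (Z_j^{(n)})′^{~10} ∪ ⋃_i (Z_{j+1}^{(i)})^{~2}.»  DATA+WF (case 3: MERGER of ≥ 1 old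
                       components and ≥ 0 new regions, ≥ 2 vertices; containment (1.84); H-GROUP convention R-G)  FIELD:
                       `PGen.join X Y s` (binary, any number at one step) ✓ faithful; (1.84)∕layers — deferred; H-GROUP = S1
                       §5 (`dictW_birth_mono`, `credit_birth_mono`) ✓; §2 `hgChain`∕`tri` decide that a faithful same-step
                       chain repeats the type `(s,2,0)` (F-1(b)(d))
T22 p.386 (1.85)      «κ_{j+1}(Z) = Σ_n(κ_j(Z_j^{(n)}) + 2p₀(g_{j(Z_j^{(n)})})) + Σ_i(γ₀A₁²p₀²(g_{j+1})(d′_{j+1}(Z_{j+1}^{(i)})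
                       +1) + 2p₀(g_{j+1})) − O(1)M^dR_{j+1}^{d+1}d′_{j+1}(Z) − 2p₀(g_{j(Z)}).»            EST (P1) —
T23 p.386 l.15–30     «Define the graph G in the following way: the set of vertices of G is {Z_j^{(n)}, Z_{j+1}^{(i)}}, and
                       a pair of domains is a line in G if the union of corresponding domains in (1.84) is a connected
                       domain, i.e., if the corresponding domains intersect, or touch each other. By (1.84) the graph G is
                       connected. Take a maximal tree graph contained in the graph G. … Take one of them, and denote the
                       corresponding domain in (1.84) by X. … Denote this domain by Y. … we have Z ⊂ X ∪ Y.»  WF (the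
                       touch-graph of a merger is connected); DATA∕RD (binary reduction along a maximal tree: `Gen.merge`
                       chain, `JoinArity`)  FIELD: `PGen.join` with «endpoint X, rest Y» = print's own binarisation ✓;
                       connectedness of G — deferred (geometric); `JoinArity` of ruling R-A v1.4 is NOT defined in S1 v1 —
                       superseded by `TypeNodup` (v1.5), which §2 `tri` shows is what a one-step triple join violates
T24 p.386 (1.86)      «κ_{j+1}(Z) = κ_{j+1}(X) + κ_{j+1}(Y) + 2p₀(g_{j(X)}) + 2p₀(g_{j(Y)}) − 2p₀(g_{j(Z)}) + O(1)M^dR_{j+1}^{d+1}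
                       d′_{j+1}(X) + O(1)M^dR_{j+1}^{d+1}d′_{j+1}(Y) − O(1)M^dR_{j+1}^{d+1}d′_{j+1}(Z).»      EST —
T25 p.386 l.−4,−3     «The index j(Z) is equal to one of the indices j(X), j(Y), hence 2p₀(g_{j(X)}) + 2p₀(g_{j(Y)}) −
                       2p₀(g_{j(Z)}) ≥ 2(1+β₀)^{−1}p₀(g_{j+1}).»             RD (`Gen.rootStep (merge) = min`); EST —  FIELD: `PGen.rootStep (join) = min` ✓
T26 p.386 last display «The domain Z is connected, and Z ⊂ X ∪ Y, hence d′_{j+1}(X) + d′_{j+1}(Y) + 2d ≥ d′_{j+1}(Z),»  WF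
                       (components are face-connected); [K] `B16MergeGeometry` —  FIELD: — deferred
T27 p.387 (1.87)      «κ_{j+1}(Z) ≥ κ_{j+1}(X) + κ_{j+1}(Y) + 2(1+β₀)^{−1}p₀(g_{j+1}) − O(1)2dM^dR_{j+1}^{d+1}.»  EST (P3) —
T28 p.387 l.3–6       «The domains X, Y intersect, or at least touch each other, hence the intersection of S^{n−j−1}(X),
                       S^{n−j−1}(Y), for n > j+1, contains at least a cube of the size 20MR_n. This implies that
                       d′_n(S^{n−j−1}(Z)) ≤ d′_n(S^{n−j−1}(X)) + d′_n(S^{n−j−1}(Y)).»                  [K] geometry —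
T29 p.387 l.7–13      «The domains X, Y determine the corresponding indices K₁, K₂. … we may assume that, for example
                       K₁ ≤ K₂. The domain S^{K₁}(X) satisfies the conditions (i), (ii), in particular it is contained in a
                       cube of the size 100MR_{j+1+K₁}, and it intersects the domains S^{K₁}(Y). It is clear that applying
                       n₁ times the operation S to the last domain, where n₁ is a rather small number, e.g., n₁ < 10, we
                       obtain the domain S^{K₁+n₁}(Y) containing S^{K₁+n₁}(X). This implies that S^{n−j−1}(Z) = S^{n−j−1}(Y)
                       for n ≥ j+1+K₁+n₁, and that K ≤ K₂ + n₁ + R_{j+1}.»  RD (`dictW (s,2,·) = n₁ + R_s` placed at the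
                       later partner reach, `Gen.reach (merge) = max + W`); WF (a merged component stays ONE pending
                       component until its own readiness)  FIELD: booked side via `toGen`∕`Gen.reach` ✓ and `JoinInLife W`
                       (joins inside both BOOKED lives); physical «K ≤ K₂ + n₁ + R_{j+1}» — deferred ([K]
                       `B16MergeHorizon.find_stopAt_merge_le`)
T30 p.387 (1.88)      «… ≤ κ_{j+1}(X) + κ_{j+1}(Y) + O(1)2(100M)^dR_{j+1}^{d+2} ≤ κ_{j+1}(Z) − 2(1+β₀)^{−1}p₀(g_{j+1}) +
                       O(1)3(100M)^dR_{j+1}^{d+2} ≤ κ_{j+1}(Z), for p₀ large and γ small enough. This completes the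
                       inductive proof of the statement.»                                                EST —
T31 p.387             «At first, the domain X in the definition (1.71) satisfies the assumption of the statement with
                       K = 0, therefore κ_k(X) ≥ 0, and we have the fundamental inequality (1.89) T′_k(X)1 ≤
                       exp(−2(1+β₀)^{−1}p₀(g_k)).»                                                EST (G2, (1.89)) —
T32 p.387             «The inequality (1.80) holds quite generally for such regions, hence also an improved bound (1.89),
                       with the additional term −κ₁d_k(X) in the exponential. This implies the inequality (2.50) [III],
                       hence Corollary 3.»                                       EST∕junction (G1, `T4StabilitySocket`) —
-/

/-! ## §2 Toy model constants and the four printed cases as `PGen` skeletons (decided) -/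

section Toys

open PGen

/-- Model constants for the sanity checks; only `n₁ = 1` matters (merger window `n₁ + R s`). [folklore] -/
def Cs : T4PrintedShapeBanking.Consts :=
  { n₁ := 1, dC := 1, q' := 1, E₂ := 1, E₃ := 1, κ₁ := 1, E₀ := 1, Eb := 1, μ := 1, a := 1, A₀ := 1, p₀ := 1 }

/-- the constant toy run `R ≡ 1`: birth window `fatWait d′ + 2`, renewal window `2`, merger window `n₁ + 1 = 2` [folklore] -/
def Rs : ℕ → ℕ := fun _ => 1

/-- the toy window table [folklore] -/
abbrev Ws : PEv → ℕ := dictW Rs Cs.n₁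

/-- the fat waiting times of the toy classes `0, 1, 2` are all `1` (`max 1 ⌊log₂ d′⌋`) [folklore] -/
theorem fatWait_toys : fatWait 0 = 1 ∧ fatWait 1 = 1 ∧ fatWait 2 = 1 := by decide

/-- (D1∕T3∕T17) ONE REGION, NO EVENT: a class-`0` region born at step `0` at cell `7`. [folklore] -/
def lone : PGen ℕ := birth 0 0 7

/-- (D2∕T4∕T20) A RENEWAL AT THE BOOKED REACH: `lone` is ready at `h = 2` and renewed at `h + 1 = 3 = reach`. [folklore] -/
def ren : PGen ℕ := renew lone 2

/-- (F-1(c), T20 «hence K = R_{j+1}» read physically) A RENEWAL BEFORE THE BOOKED REACH: physically admissible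
(`Adm`), but not `RenewAtReach` — outside the certifiable sub-class. [folklore] -/
def renEarly : PGen ℕ := renew lone 1

/-- (D3 m1∕T21) AN m1 MERGER: the old component `lone` absorbs a NEW class-`1` region born AT the merger step `2`.
[folklore] -/
def m1 : PGen ℕ := join lone (birth 2 1 9) 2

/-- (D3 m2∕T21∕T23) AN m2 MERGER: two OLD components (born at `0`, classes `0` and `1`, cells `7` and `20`) joined at
step `2`. [folklore] -/
def m2 : PGen ℕ := join lone (birth 0 1 20) 2

/-- (F-1(d)) the commonest m2 merger — two unit regions of the SAME class born at the same step — joined inside their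
booked lives (the owner's `Sanity.twin` joins at the booked reach `3`; this one at `2`). [folklore] -/
def twin2 : PGen ℕ := join (birth 0 1 5) (birth 0 1 9) 2

/-- (R-G, H-GROUP; T21 «some number of new large field regions») TWO new regions (classes `1`, `2`) attaching to
`lone` at ONE step, recorded FAITHFULLY as a chain of two binary joins dated `2`. [folklore] -/
def hgChain : PGen ℕ := join (join lone (birth 2 1 9) 2) (birth 2 2 11) 2

/-- … and recorded by the CONVENTION H-GROUP: one birth of the larger class `2`. [folklore] -/
def hgGrouped : PGen ℕ := join lone (birth 2 2 9) 2

/-- (F-1(b); T23 «some number of components») THREE old components joined at ONE step: two binary joins dated `2`.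
[folklore] -/
def tri : PGen ℕ := join (join (birth 0 0 1) (birth 0 1 2) 2) (birth 0 2 3) 2

/-- … the same join SERIALISED over steps `2`, `3` (the tempting relabelling). [folklore] -/
def triSerial : PGen ℕ := join (join (birth 0 0 1) (birth 0 1 2) 2) (birth 0 2 3) 3

/-! ### Root data (T7: «j(Z) is the index of a first large field region contained in Z») -/

/-- root step, root cell and number of constituents of the toys [folklore] -/
theorem roots :
    lone.rootStep = 0 ∧ lone.rootCell = 7 ∧ lone.regions = 1 ∧
    ren.rootStep = 0 ∧ ren.rootCell = 7 ∧ ren.lastStep = 3 ∧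
    m1.rootStep = 0 ∧ m1.rootCell = 7 ∧ m1.regions = 2 ∧ m1.lastStep = 2 ∧
    m2.rootStep = 0 ∧ m2.rootCell = 7 ∧ m2.regions = 2 ∧
    hgChain.regions = 3 ∧ hgGrouped.regions = 2 ∧ tri.rootCell = 1 ∧ tri.regions = 3 := by decide

/-! ### Event types: which toys the landed carrier can label (`TypeNodup`, decided) -/

/-- the four printed cases and the grouped∕serialised conventions have pairwise distinct event types … [folklore] -/
theorem typeNodup_toys : lone.TypeNodup ∧ ren.TypeNodup ∧ renEarly.TypeNodup ∧ m1.TypeNodup ∧ m2.TypeNodup ∧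
    hgGrouped.TypeNodup ∧ triSerial.TypeNodup := by decide

/-- … while the equal-class twin, the faithful two-region chain (event `(2,2,0)` twice) and the one-step triple join
(event `(2,2,0)` twice) repeat an event type: NO well-formed canonical label (`not_wf_toGen`). [folklore] -/
theorem not_typeNodup_toys : ¬ twin2.TypeNodup ∧ ¬ hgChain.TypeNodup ∧ ¬ tri.TypeNodup := by decide

/-- hence no window table makes their canonical labels well formed [folklore] -/
theorem not_wf_toys (W : PEv → ℕ) : ¬ twin2.toGen.WF W ∧ ¬ hgChain.toGen.WF W ∧ ¬ tri.toGen.WF W :=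
  ⟨not_wf_toGen not_typeNodup_toys.1 W, not_wf_toGen not_typeNodup_toys.2.1 W,
    not_wf_toGen not_typeNodup_toys.2.2 W⟩

/-! ### Print's timing discipline `Adm` (T4∕T19–T21: events after all earlier events, observed by the cutoff) -/

/-- every toy obeys the timing discipline at cutoff `3` (physical admissibility is NOT the obstruction) [folklore] -/
theorem adm_toys : lone.Adm 3 ∧ ren.Adm 3 ∧ renEarly.Adm 3 ∧ m1.Adm 3 ∧ m2.Adm 3 ∧ twin2.Adm 3 ∧ hgChain.Adm 3 ∧
    hgGrouped.Adm 3 ∧ tri.Adm 3 ∧ triSerial.Adm 3 := by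
  simp [lone, ren, renEarly, m1, m2, twin2, hgChain, hgGrouped, tri, triSerial, Adm, lastStep]

/-! ### The booked windows (V2∕T15∕T20∕T29 as booked by `dictW`) and the two model-time side conditions -/

/-- the toy windows: class-`0`∕`1`∕`2` births wait `fatWait d′ + R + 1 = 3`, a renewal `R + 1 = 2`, a merger
`n₁ + R = 2` [folklore] -/
theorem windows : Ws (0, 0, 0) = 3 ∧ Ws (2, 0, 1) = 3 ∧ Ws (2, 0, 2) = 3 ∧ Ws (3, 1, 0) = 2 ∧ Ws (2, 2, 0) = 2 := by
  simp [Ws, Rs, Cs, fatWait_toys.1, fatWait_toys.2.1, fatWait_toys.2.2]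

/-- the booked reaches of the labels: `lone` `0 + 3`; `ren` `3 + 2`; `m1` `max 3 5 + 2`; `m2` `max 3 3 + 2` [folklore] -/
theorem reaches : lone.toGen.reach Ws = 3 ∧ ren.toGen.reach Ws = 5 ∧ m1.toGen.reach Ws = 7 ∧ m2.toGen.reach Ws = 5 ∧
    twin2.toGen.reach Ws = 5 ∧ hgGrouped.toGen.reach Ws = 7 := by
  simp [lone, ren, m1, m2, twin2, hgGrouped, toGen, Gen.reach, Ws, Rs, Cs, fatWait_toys.1, fatWait_toys.2.1,
    fatWait_toys.2.2]

/-- `RenewAtReach`: `ren` renews exactly at the booked reach `3`; `renEarly` (renewed at `2 < 3`) does NOT — the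
located side condition F-1(c) separates two physically admissible histories [folklore] -/
theorem renewAtReach_toys : ren.RenewAtReach Ws ∧ ¬ renEarly.RenewAtReach Ws ∧ m1.RenewAtReach Ws ∧
    m2.RenewAtReach Ws ∧ twin2.RenewAtReach Ws ∧ hgGrouped.RenewAtReach Ws ∧ triSerial.RenewAtReach Ws := by
  simp [ren, renEarly, m1, m2, twin2, hgGrouped, triSerial, lone, RenewAtReach, toGen, Ws, Rs, Cs, fatWait_toys.1]

/-- `JoinInLife`: the m1∕m2∕twin∕grouped joins happen inside both partners' booked lives; the SERIALISED triple join
does NOT (its third partner's booked life `[0, 3)` is over at step `3`) — serialising a one-step multi-join over later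
steps leaves the certifiable sub-class, as the owner's F-1(b) says [folklore] -/
theorem joinInLife_toys : m1.JoinInLife Ws ∧ m2.JoinInLife Ws ∧ twin2.JoinInLife Ws ∧ hgGrouped.JoinInLife Ws ∧
    tri.JoinInLife Ws ∧ ¬ triSerial.JoinInLife Ws := by
  simp [m1, m2, twin2, hgGrouped, tri, triSerial, lone, JoinInLife, toGen, Gen.reach, Ws, Rs, Cs, fatWait_toys.1,
    fatWait_toys.2.1, fatWait_toys.2.2]

/-! ### The positive half applied: the labels of the four printed cases are `Consistent` and well formed -/

/-- `lone`, `ren`, `m1`, `m2` (and the grouped chain) have `Consistent` canonical labels at cutoff `3`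
(`consistent_toGen`) [folklore] -/
theorem consistent_toys : Consistent Cs 3 Rs lone.toGen ∧ Consistent Cs 3 Rs ren.toGen ∧ Consistent Cs 3 Rs m1.toGen ∧
    Consistent Cs 3 Rs m2.toGen ∧ Consistent Cs 3 Rs hgGrouped.toGen :=
  ⟨consistent_toGen Cs 3 Rs adm_toys.1 trivial trivial,
    consistent_toGen Cs 3 Rs adm_toys.2.1 renewAtReach_toys.1 (by simp [ren, lone, JoinInLife]),
    consistent_toGen Cs 3 Rs adm_toys.2.2.2.1 renewAtReach_toys.2.2.1 joinInLife_toys.1,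
    consistent_toGen Cs 3 Rs adm_toys.2.2.2.2.1 renewAtReach_toys.2.2.2.1 joinInLife_toys.2.1,
    consistent_toGen Cs 3 Rs adm_toys.2.2.2.2.2.2.2.1 renewAtReach_toys.2.2.2.2.2.1 joinInLife_toys.2.2.2.1⟩

/-- … and well-formed ones (`wf_toGen`, using `TypeNodup`) [folklore] -/
theorem wf_toys : lone.toGen.WF Ws ∧ ren.toGen.WF Ws ∧ m1.toGen.WF Ws ∧ m2.toGen.WF Ws ∧ hgGrouped.toGen.WF Ws :=
  ⟨wf_toGen (K := 3) Ws typeNodup_toys.1 adm_toys.1 trivial trivial,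
    wf_toGen (K := 3) Ws typeNodup_toys.2.1 adm_toys.2.1 renewAtReach_toys.1 (by simp [ren, lone, JoinInLife]),
    wf_toGen (K := 3) Ws typeNodup_toys.2.2.2.1 adm_toys.2.2.2.1 renewAtReach_toys.2.2.1 joinInLife_toys.1,
    wf_toGen (K := 3) Ws typeNodup_toys.2.2.2.2.1 adm_toys.2.2.2.2.1 renewAtReach_toys.2.2.2.1 joinInLife_toys.2.1,
    wf_toGen (K := 3) Ws typeNodup_toys.2.2.2.2.2.1 adm_toys.2.2.2.2.2.2.2.1 renewAtReach_toys.2.2.2.2.2.1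
      joinInLife_toys.2.2.2.1⟩

/-- THE TWIN IS `Consistent` BUT HAS NO WELL-FORMED LABEL: consistency does not see event multiplicities, well-formedness
does (decided instance of the carrier debt F-1(d)) [folklore] -/
theorem twin2_consistent_not_wf : Consistent Cs 3 Rs twin2.toGen ∧ ¬ twin2.toGen.WF Ws :=
  ⟨consistent_toGen Cs 3 Rs adm_toys.2.2.2.2.2.1 renewAtReach_toys.2.2.2.2.1 joinInLife_toys.2.2.1, (not_wf_toys Ws).1⟩

/-- `renEarly`'S LABEL IS NOT `Consistent` (the landed clause pins renewals to the booked reach) although the history is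
physically admissible [folklore] -/
theorem renEarly_not_consistent : renEarly.Adm 3 ∧ ¬ Consistent Cs 3 Rs renEarly.toGen := by
  refine ⟨adm_toys.2.2.1, ?_⟩
  simp [renEarly, lone, toGen, Consistent, Gen.reach, Rs, Cs, fatWait_toys.1]

/-! ### Pending at the cutoff (the socket's `pending` field shape `K < reach`) -/

/-- at cutoff `2` all four printed toys are pending in the booked ledger; `lone` alone is integrated out by step `3`
(`¬ 3 < 3`), `m2` by `5` [folklore] -/
theorem pending_toys : 2 < lone.toGen.reach Ws ∧ ¬ 3 < lone.toGen.reach Ws ∧ 3 < ren.toGen.reach Ws ∧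
    3 < m1.toGen.reach Ws ∧ 3 < m2.toGen.reach Ws ∧ ¬ 5 < m2.toGen.reach Ws := by
  simp [reaches.1, reaches.2.1, reaches.2.2.1, reaches.2.2.2.1]

/-! ### H-GROUP is conservative on the toy (§5 of S1 instantiated) -/

/-- grouping the two step-`2` regions (classes `1`, `2`) into one class-`2` birth books a window and a credit no
smaller than each constituent's [folklore] -/
theorem hgroup_toy (g : ℕ → ℝ) :
    Ws (2, 0, 1) ≤ Ws (2, 0, 2) ∧ credit Cs g (2, 0, 1) ≤ credit Cs g (2, 0, 2) :=
  ⟨dictW_birth_mono Rs Cs.n₁ 2 (by norm_num), credit_birth_mono Cs g (by norm_num [Cs]) 2 (by norm_num)⟩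

end Toys

end Summit.QuantumFields.BalabanUV.T4Continuum.HistoryAdmissibleSanity
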